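import Mathlib
import Literature.RepresentationTheory.AlgebraicGroups.HilbertMumfordTensorValuation
import HarnessLib

/-!
# Hilbert–Mumford for `SL_m(ℂ)³` on `3`-tensors, IV′: the orbit map and a Nullstellensatz transfer

Auxiliary file of the proof of `Kempf1978_thm14_tensor`; theorems only, no new imports beyond
file I (`HilbertMumfordTensorValuation`).

* `det_genericMatrix_mk_eq_one` — `det X̄⁽ᵖ⁾ = 1` in the coordinate ring `ℂ[x]/J` of `SL_ι³`
  (`J = (det X⁽ᵖ⁾ - 1 : p)`, passed as a parameter with its defining equation);
* `isClosed_range_orbit_uncurry` — the uncurried orbit `{(g·w)~} ⊆ ℂ^{ι³}` is closed when the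
  orbit is;
* `image_orbitMap_subset` — the orbit map `x ↦ (X·w)(x)` sends `V(J)(ℂ)` into the orbit of `w`;
* `exists_zero_of_eval₂_eq_zero` — a polynomial system over `ℂ` with a solution in some field
  `κ ⊇ ℂ` has a solution in `ℂ` (weak Nullstellensatz).
-/

noncomputable section

open MvPolynomial Matrix
open scoped BigOperators

namespace Literature.RepresentationTheory.AlgebraicGroups

open Literature.Computability.AlgebraicComplexity

/-- **Nullstellensatz transfer.** A polynomial system over `ℂ` (an ideal `I ⊆ ℂ[x_σ]`, `σ` finite)
with a solution in some field `κ` along a ring map `ρ : ℂ → κ` has a solution in `ℂ`. [folklore] -/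
theorem exists_zero_of_eval₂_eq_zero {σ : Type*} [Finite σ] (I : Ideal (MvPolynomial σ ℂ))
    {κ : Type*} [Field κ] (ρ : ℂ →+* κ) (x : σ → κ) (hx : ∀ q ∈ I, eval₂ ρ x q = 0) :
    ∃ y : σ → ℂ, ∀ q ∈ I, aeval y q = 0 := by
  by_contra hne
  have hempty : zeroLocus ℂ I = ∅ := by
    ext y
    simp only [Set.mem_empty_iff_false, iff_false]
    intro hy
    exact hne ⟨y, mem_zeroLocus_iff.mp hy⟩
  have hone : (1 : MvPolynomial σ ℂ) ∈ I := by
    have h1 : (1 : MvPolynomial σ ℂ) ∈ vanishingIdeal ℂ (zeroLocus ℂ I) := by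
      rw [hempty, mem_vanishingIdeal_iff]
      intro x hx
      exact hx.elim
    rw [vanishingIdeal_zeroLocus_eq_radical] at h1
    obtain ⟨n, hn⟩ := Ideal.mem_radical_iff.mp h1
    rwa [one_pow] at hn
  have := hx 1 hone
  rw [eval₂_one] at this
  exact one_ne_zero this

section Main

variable {ι : Type} [Fintype ι] [DecidableEq ι]

/-- The generic matrices reduce to the identity-determinant relation: `det X̄⁽ᵖ⁾ = 1` in
`ℂ[x]/J`. [folklore] -/
theorem det_genericMatrix_mk_eq_one (J : Ideal (MvPolynomial (Fin 3 × ι × ι) ℂ))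
    (hJ : J = Ideal.span (Set.range fun p : Fin 3 =>
      (Matrix.of fun i j => (X (p, i, j) : MvPolynomial (Fin 3 × ι × ι) ℂ)).det - 1)) (p : Fin 3) :
    (Matrix.of fun i j => Ideal.Quotient.mk J (X (p, i, j))).det = 1 := by
  have : (Matrix.of fun i j => Ideal.Quotient.mk J (X (p, i, j))) =
      (Ideal.Quotient.mk J).mapMatrix (Matrix.of fun i j =>
        (X (p, i, j) : MvPolynomial (Fin 3 × ι × ι) ℂ)) := by
    ext i j; rfl
  rw [this, ← RingHom.map_det, ← map_one (Ideal.Quotient.mk J), Ideal.Quotient.eq, hJ]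
  exact Ideal.subset_span ⟨p, rfl⟩

/-- The uncurried orbit `{(g·w)~} ⊆ ℂ^{ι³}` is closed when the orbit is. [folklore] -/
theorem isClosed_range_orbit_uncurry (w : ι → ι → ι → ℂ)
    (hclosed : IsClosed (Set.range fun g : Matrix.SpecialLinearGroup ι ℂ ×
        Matrix.SpecialLinearGroup ι ℂ × Matrix.SpecialLinearGroup ι ℂ =>
      (fun a b c => ∑ a', ∑ b', ∑ c', (g.1 : Matrix ι ι ℂ) a a' * (g.2.1 : Matrix ι ι ℂ) b b' *
        (g.2.2 : Matrix ι ι ℂ) c c' * w a' b' c'))) :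
    IsClosed (Set.range fun g : Matrix.SpecialLinearGroup ι ℂ ×
        Matrix.SpecialLinearGroup ι ℂ × Matrix.SpecialLinearGroup ι ℂ => fun c : ι × ι × ι =>
          actTensor (g.1 : Matrix ι ι ℂ) (g.2.1 : Matrix ι ι ℂ) (g.2.2 : Matrix ι ι ℂ) w
            c.1 c.2.1 c.2.2) := by
  have hcont' : Continuous fun t' : ι × ι × ι → ℂ => fun a b c => t' (a, b, c) :=
    continuous_pi fun a => continuous_pi fun b => continuous_pi fun c => continuous_apply _
  have hpre := hclosed.preimage hcont'
  convert hpre using 1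
  ext t'
  simp only [Set.mem_range, Set.mem_preimage]
  constructor
  · rintro ⟨g, rfl⟩; exact ⟨g, rfl⟩
  · rintro ⟨g, hg⟩
    refine ⟨g, ?_⟩
    funext c
    have := congr_fun (congr_fun (congr_fun hg c.1) c.2.1) c.2.2
    simp only [Prod.mk.eta] at this
    exact this

/-- **The orbit map has image the orbit**: the image of `V(J)(ℂ) = SL_ι(ℂ)³` under
`x ↦ (X·w)(x)` is `{(g·w)~}`. [folklore] -/
theorem image_orbitMap_subset (w : ι → ι → ι → ℂ) (J : Ideal (MvPolynomial (Fin 3 × ι × ι) ℂ))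
    (hJ : J = Ideal.span (Set.range fun p : Fin 3 =>
      (Matrix.of fun i j => (X (p, i, j) : MvPolynomial (Fin 3 × ι × ι) ℂ)).det - 1)) :
    (fun (x : Fin 3 × ι × ι → ℂ) (t : ι × ι × ι) => aeval x
        (actTensor (Matrix.of fun i j => (X ((0 : Fin 3), i, j) : MvPolynomial (Fin 3 × ι × ι) ℂ))
          (Matrix.of fun i j => (X ((1 : Fin 3), i, j) : MvPolynomial (Fin 3 × ι × ι) ℂ))
          (Matrix.of fun i j => (X ((2 : Fin 3), i, j) : MvPolynomial (Fin 3 × ι × ι) ℂ))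
          (fun a b c => C (w a b c)) t.1 t.2.1 t.2.2)) ''
        {x | ∀ q ∈ J, aeval x q = 0} ⊆
      Set.range fun g : Matrix.SpecialLinearGroup ι ℂ × Matrix.SpecialLinearGroup ι ℂ ×
        Matrix.SpecialLinearGroup ι ℂ => fun c : ι × ι × ι => actTensor (g.1 : Matrix ι ι ℂ)
          (g.2.1 : Matrix ι ι ℂ) (g.2.2 : Matrix ι ι ℂ) w c.1 c.2.1 c.2.2 := by
  classical
  rintro _ ⟨x, hx, rfl⟩
  set gx : Fin 3 → Matrix ι ι ℂ := fun p => Matrix.of fun i j => x (p, i, j) with hgx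
  have hdet : ∀ p, (gx p).det = 1 := by
    intro p
    have h := hx _ (by rw [hJ]; exact Ideal.subset_span ⟨p, rfl⟩)
    rw [map_sub, map_one, AlgHom.map_det, sub_eq_zero] at h
    convert h using 2
    ext i j; simp [hgx]
  refine ⟨(⟨gx 0, hdet 0⟩, ⟨gx 1, hdet 1⟩, ⟨gx 2, hdet 2⟩), funext fun c => ?_⟩
  simp only
  rw [map_actTensor]
  have e1 : ∀ p : Fin 3, (Matrix.of fun i j => (X (p, i, j) : MvPolynomial (Fin 3 × ι × ι) ℂ)).map
      (aeval x) = gx p := fun p => by ext i j; simp [hgx]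
  have e2 : (fun a b c' => aeval x (C (w a b c') : MvPolynomial (Fin 3 × ι × ι) ℂ)) = w := by
    funext a b c'; simp
  rw [e1, e1, e1, e2]

end Main

end Literature.RepresentationTheory.AlgebraicGroups
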